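import Summits.AtomisticToContinuum.Crystallization.Theorems.ExcessDecayLiouvilleHcpLiouvilleBlowdownGreenAssemblyAB
import Summits.AtomisticToContinuum.Crystallization.Theorems.ExcessDecayLiouvilleHcpLiouvilleBlowdownGreenOpticalB
import Summits.AtomisticToContinuum.Crystallization.Theorems.ExcessDecayLiouvilleHcpLiouvilleBlowdownPathSup
import Summits.AtomisticToContinuum.Crystallization.Theorems.ExcessDecayLiouvilleHcpLiouvilleBlowdownCapacity
import Summits.AtomisticToContinuum.Crystallization.Theorems.ExcessDecayLiouvilleHcpLiouvilleBlowdownGreenSolve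

/-!
# `ExcessDecayLiouville.HcpLiouville` (stmt-AtomisticToContinuum-9332), line `Sketch` v4: stub (H) `stub_green`

The lattice Green's operator `L⁻¹ div` is `ℓ^{1,1} → ℓ²` on every admissible two-lattice satisfying `PSIneq κ`
(`Blowdown.GreenProp κ C`), assembled from the registered sub-goals: the path bound `blowdown_pathSup` (H0), the capacity
inequality `blowdown_capacity` (H1), the solution operator by exhaustion `blowdown_greenSolve` (H2), and the lead's
dipole decomposition (GreenL2 / GreenShift / GreenOptical A,B / GreenCross A,B1,B2 / GreenAssembly A,B).
All `[folklore]`; a `--supports` helper for item stmt-AtomisticToContinuum-9332 (registered stub `stub_green`).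
-/

noncomputable section

namespace Summit.AtomisticToContinuum.Crystallization.Theorems.ExcessDecayLiouville

open scoped BigOperators Topology Classical InnerProductSpace RealInnerProductSpace
open Literature.MathematicalPhysics.StatisticalMechanics
open Summit.AtomisticToContinuum.Crystallization.Theses.ExcessDecayLiouville
open Summit.AtomisticToContinuum.Crystallization.Theorems.PhononStabilityNegative

/-- **Stub (H) of the line `Sketch`**: `∀ κ > 0, ∃ C, Blowdown.GreenProp κ C`. [folklore] -/
theorem stub_green : ∀ κ : ℝ, 0 < κ → ∃ C : ℝ, Blowdown.GreenProp κ C := by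
  intro κ hκ
  obtain ⟨Cp, hpathAll⟩ := blowdown_pathSup
  obtain ⟨Cc, hcapAll⟩ := blowdown_capacity
  obtain ⟨Cg, hGall⟩ := blowdown_greenSolve
  set C₀ : ℝ := |Cp| with hC₀
  set C₁ : ℝ := |Cc| with hC₁
  set C₂ : ℝ := |Cg| with hC₂
  set Ccr : ℝ := (1 + 38 * ((1100 / 189 : ℝ) * (C₂ / κ * Real.sqrt C₁)) *
    (1024 / ((23 / 25 : ℝ) ^ 3 * (23 / 25 : ℝ) ^ 5) + 1024 / ((23 / 25 : ℝ) ^ 3 * (23 / 25 : ℝ) ^ 4))) / κ with hCcr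
  have hC₀0 : 0 ≤ C₀ := abs_nonneg _
  have hC₂0 : 0 ≤ C₂ := abs_nonneg _
  have hCcr0 : 0 ≤ Ccr := by positivity
  refine ⟨(((((1100 / 189 : ℝ) * (C₂ / κ * Real.sqrt C₁)) + Ccr) / 2)) ^ 2, ?_⟩
  intro t A hA hI hPS M hM hW
  -- per-datum hypotheses with nonnegative constants
  have hpath : ∀ w : EuclideanSpace ℝ (Fin 3) → EuclideanSpace ℝ (Fin 3), (Function.support w).Finite →
      Function.support w ⊆ Sites₀ t A → ∀ p ∈ Sites₀ t A, ∀ q ∈ Sites₀ t A,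
        ‖w p - w q‖ ≤ C₀ * (1 + dist p q) * Real.sqrt (nnForm t A w) := by
    intro w hw hwS p hp q hq
    refine (hpathAll t A hA hI w hw hwS p hp q hq).trans ?_
    have : 0 ≤ (1 + dist p q) * Real.sqrt (nnForm t A w) := by positivity
    calc Cp * (1 + dist p q) * Real.sqrt (nnForm t A w) = Cp * ((1 + dist p q) * Real.sqrt (nnForm t A w)) := by ring
      _ ≤ |Cp| * ((1 + dist p q) * Real.sqrt (nnForm t A w)) := mul_le_mul_of_nonneg_right (le_abs_self _) this
      _ = _ := by ring
  have hcap : ∀ w : EuclideanSpace ℝ (Fin 3) → EuclideanSpace ℝ (Fin 3), (Function.support w).Finite →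
      Function.support w ⊆ Sites₀ t A → ∀ p ∈ Sites₀ t A, ‖w p‖ ^ 2 ≤ C₁ * nnForm t A w := by
    intro w hw hwS p hp
    exact (hcapAll t A hA hI w hw hwS p hp).trans (mul_le_mul_of_nonneg_right (le_abs_self _) (nnForm_nonneg t A w))
  obtain ⟨𝒢, hG, hvii, hviii, hix⟩ := hGall κ t A hκ hA hI hPS
  have hsq : ∀ N : ℝ, (Cg / κ * N) ^ 2 = (C₂ / κ * N) ^ 2 := fun N => by
    rw [hC₂, ← sq_abs (Cg / κ * N), ← sq_abs (|Cg| / κ * N)]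
    congr 1
    rw [abs_mul, abs_mul, abs_div, abs_div, abs_abs]
  have hi : ∀ (f : EuclideanSpace ℝ (Fin 3) → EuclideanSpace ℝ (Fin 3)) (N : ℝ), 0 ≤ N →
      (∀ w : EuclideanSpace ℝ (Fin 3) → EuclideanSpace ℝ (Fin 3), (Function.support w).Finite →
        Function.support w ⊆ Sites₀ t A → |∑' p : Sites₀ t A, ⟪f p, w p⟫| ≤ N * Real.sqrt (nnForm t A w)) →
      ∀ p : Sites₀ t A, HasSum (fun q : Sites₀ t A =>
        forceConst ((p : EuclideanSpace ℝ (Fin 3)) - q) (𝒢 f p - 𝒢 f q)) (f p) :=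
    fun f N hN hadm => (hG f N hN hadm).1
  have hiv : ∀ (f : EuclideanSpace ℝ (Fin 3) → EuclideanSpace ℝ (Fin 3)) (N : ℝ), 0 ≤ N →
      (∀ w : EuclideanSpace ℝ (Fin 3) → EuclideanSpace ℝ (Fin 3), (Function.support w).Finite →
        Function.support w ⊆ Sites₀ t A → |∑' p : Sites₀ t A, ⟪f p, w p⟫| ≤ N * Real.sqrt (nnForm t A w)) →
      ∀ e ∈ ({triangularVec₁ 1, triangularVec₂ 1, layerNormal (2 * Real.sqrt (2 / 3))} : Finset (EuclideanSpace ℝ (Fin 3))),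
        Summable (fun p : Sites₀ t A => ‖𝒢 f (p + A e) - 𝒢 f p‖ ^ 2) ∧
        ∑' p : Sites₀ t A, ‖𝒢 f (p + A e) - 𝒢 f p‖ ^ 2 ≤ (C₂ / κ * N) ^ 2 := by
    intro f N hN hadm e he
    have h := (hG f N hN hadm).2.2.2.2.1 e he
    rw [hsq N] at h
    exact h
  have hv : ∀ (f : EuclideanSpace ℝ (Fin 3) → EuclideanSpace ℝ (Fin 3)) (N : ℝ), 0 ≤ N →
      (∀ w : EuclideanSpace ℝ (Fin 3) → EuclideanSpace ℝ (Fin 3), (Function.support w).Finite →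
        Function.support w ⊆ Sites₀ t A → |∑' p : Sites₀ t A, ⟪f p, w p⟫| ≤ N * Real.sqrt (nnForm t A w)) →
      ∀ c : ℝ, ∀ p ∈ Sites₀ t A, 𝒢 (c • f) p = c • 𝒢 f p :=
    fun f N hN hadm => (hG f N hN hadm).2.2.2.2.2.1
  have hvi : ∀ (f : EuclideanSpace ℝ (Fin 3) → EuclideanSpace ℝ (Fin 3)) (N : ℝ), 0 ≤ N →
      (∀ w : EuclideanSpace ℝ (Fin 3) → EuclideanSpace ℝ (Fin 3), (Function.support w).Finite →
        Function.support w ⊆ Sites₀ t A → |∑' p : Sites₀ t A, ⟪f p, w p⟫| ≤ N * Real.sqrt (nnForm t A w)) →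
      ∀ e ∈ Λ₀, (∀ w : EuclideanSpace ℝ (Fin 3) → EuclideanSpace ℝ (Fin 3), (Function.support w).Finite →
        Function.support w ⊆ Sites₀ t A →
          |∑' p : Sites₀ t A, ⟪(fun x => f (x - A e)) p, w p⟫| ≤ N * Real.sqrt (nnForm t A w)) →
      ∀ p ∈ Sites₀ t A, 𝒢 (fun x => f (x - A e)) p = 𝒢 f (p - A e) :=
    fun f N hN hadm => (hG f N hN hadm).2.2.2.2.2.2
  -- the optical block and the cross pair
  have hopt : ∀ ξ : EuclideanSpace ℝ (Fin 3), κ * ‖ξ‖ ^ 2 ≤ ∑' z : Λ₀, ⟪forceConst (t 0 - (t 1 + A z)) ξ, ξ⟫ :=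
    fun ξ => blowdown_opticalLimit κ t A hA hI ξ _ (blowdown_opticalFinite κ t A hκ hA hI hPS · · ξ)
  have hcross := Blowdown.cross_bound (𝒢 := 𝒢) hA hI hκ hC₀0 hC₂0 hpath hcap hiv hv hvi hvii hviii hix hopt
  obtain ⟨hrows, hs, hle⟩ := Blowdown.green_dipole_decomposition (𝒢 := 𝒢) hA hI hκ hC₀0 hC₂0 hCcr0 hpath hcap hi hiv hv hvi
    hvii hviii hcross M hM hW
  refine ⟨𝒢 (fun x => ∑' q : Sites₀ t A, M x q), hrows, hs, hle.trans (le_of_eq ?_)⟩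
  ring

end Summit.AtomisticToContinuum.Crystallization.Theorems.ExcessDecayLiouville

end
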